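import Literature.MathematicalPhysics.QuantumLattice.HubbardTTPrimeEnergyDensityVariationalPrinciple
import HarnessLib

/-!
# The open-box consumer for MIXED fillings: a number-distribution average of open-cluster sector
# energies bounds the `t–t'` energy density at the mean density

Topic `Literature/MathematicalPhysics/QuantumLattice`; namespace
`Literature.MathematicalPhysics.QuantumLattice` (the file path). Family `hubbard` (cell sr-mbsolver,
crew (3) hubbard-upper, certificate format `plane-iv0`). HONEST FRAMING: first certified bounds; not a
superconductivity verdict.

The tree's open-box consumer `ThermodynamicLimit.energyDensityTT'_le_openBox`
(`HubbardNNNHoppingOpenClusters.lean`) turns ONE sector ground energy `E_open(a × b; N)` of the open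
`a × b` cluster of the square-lattice `t–t'–U` Hubbard model (`U ≥ 0`, `N < 2ab`) into the
thermodynamic-limit bound `e(N/(ab)) ≤ E_open(a × b; N)/(ab)`, and
`Summit….Bounds.energyDensityTT'_le_of_openBox_linear` (`OpenBoxStripLimit.lean`) takes EXACT sector
fillings along a family of boxes. A variational state of the open box that is NOT an eigenstate of the
particle number — the box marginal of a sequentially generated (isometric tensor-network / finite
light-cone circuit) plane state is block-diagonal in `N` with a number DISTRIBUTION `p_N` of width
`O(b)` around `n·ab` — certifies instead the AVERAGE `Σ_N p_N E_open(a × b; N)` (each block is a mixture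
of `N`-particle states, so its energy is at least `E_open(a × b; N)`). This file adds the consumer for that
shape:

* `energyDensityTT'_le_of_numberAverage_openBox` — if for every `ε > 0` some open `a × b` box carries a
  probability vector `p` on the fillings `0 … 2ab` with mean filling within `ε·ab` of `n·ab` and
  `Σ_N p_N E_open(a × b; N) ≤ (c + ε)·ab`, then `e(t,t',U; n) ≤ c` (`U ≥ 0`, `0 < n < 2`).

Proof (Ruelle's number-average step, exactly as inside
`InfVolFermionState.IsTranslationInvariant.energyDensityTT'_le_meanEnergy`): take a supporting line
`e(n) + s(x - n) ≤ e(x)` of the convex `e` on `[0,2)` (`exists_supporting_line_energyDensityTT'`); every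
sector `N < 2ab` lies above it by `energyDensityTT'_le_openBox`, and the filled band `E_open(2ab) = U·ab`
(`groundEnergy_hamiltonian_add_full`) by `supporting_line_energyDensityTT'_at_two_le`; averaging with the
weights `p_N` the affine terms collapse to `ab·e(n) + s(Σ_N p_N N - n·ab) ≤ (c + ε)·ab`, whence
`e(n) ≤ c + (1 + |s|)ε` for every `ε > 0`. Everything is PROVED from landed lemmas; no definition, no
named fact, no numerical input. Sources: Ruelle, *Statistical Mechanics* (1969) §3.3–3.4 (the
thermodynamic limit is controlled by sub-box energies; convexity in the density) [Ruelle1969];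
LeBlanc et al., Phys. Rev. X 5 (2015) 041041, eq. (1) (the `t–t'` model on open clusters) [LeBlancEtAl2015].
-/

noncomputable section

namespace Literature.MathematicalPhysics.QuantumLattice

namespace ThermodynamicLimit

open Finset HubbardWave0
open scoped ComplexOrder

/-- **Open-box consumer for mixed fillings (number-distribution average).** Let `U ≥ 0`, `0 < n < 2`
and `c : ℝ`. Suppose that for every `ε > 0` there are an open box `a × b` (`a, b ≥ 1`) and weights
`p_N ≥ 0` on the fillings `N = 0, …, 2ab` with `Σ_N p_N = 1`, mean filling
`|Σ_N p_N N - n·ab| ≤ ε·ab`, and averaged sector energies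
`Σ_N p_N E_open(a × b; N) ≤ (c + ε)·ab`, where `E_open(a × b; N) = groundEnergy (hubbardOpenBoxTT' a b t t' U) N`.
Then `energyDensityTT' t t' U n ≤ c`. (The hypothesis is what the box marginal of a
number-block-diagonal variational state supplies: `p_N` its number distribution, the energy bound its
certified energy plus edge terms, `ε → 0` along growing boxes.) Ruelle (1969) §3.3–3.4 for the model of
LeBlanc et al. (2015) eq. (1). [cite: Ruelle1969, §3.4] -/
theorem energyDensityTT'_le_of_numberAverage_openBox (t t' : ℝ) {U : ℝ} (hU : 0 ≤ U) {n : ℝ}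
    (hn0 : 0 < n) (hn2 : n < 2) (c : ℝ)
    (h : ∀ ε : ℝ, 0 < ε → ∃ a b : ℕ, 1 ≤ a ∧ 1 ≤ b ∧ ∃ p : ℕ → ℝ, (∀ N, 0 ≤ p N) ∧
        ∑ N ∈ range (2 * (a * b) + 1), p N = 1 ∧
        |∑ N ∈ range (2 * (a * b) + 1), p N * (N : ℝ) - n * ((a : ℝ) * (b : ℝ))| ≤ ε * ((a : ℝ) * (b : ℝ)) ∧
        ∑ N ∈ range (2 * (a * b) + 1), p N * groundEnergy (hubbardOpenBoxTT' a b t t' U) N ≤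
          (c + ε) * ((a : ℝ) * (b : ℝ))) :
    energyDensityTT' t t' U n ≤ c := by
  obtain ⟨s, hs⟩ := exists_supporting_line_energyDensityTT' t t' hU hn0 hn2
  have hs2 := supporting_line_energyDensityTT'_at_two_le t t' hU hs
  refine le_of_forall_pos_lt_add fun ε' hε' => ?_
  -- choose `ε` with `(1 + |s|) ε < ε'`
  set ε : ℝ := ε' / (2 * (1 + |s|)) with hεdef
  have hS : 0 < 1 + |s| := by positivity
  have hε : 0 < ε := by positivity
  have hεε' : (1 + |s|) * ε < ε' := by
    rw [hεdef, mul_div_assoc', div_lt_iff₀ (by positivity)]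
    nlinarith
  obtain ⟨a, b, ha, hb, p, hp0, hp1, hpN, hpE⟩ := h ε hε
  set e : ℝ := energyDensityTT' t t' U n with he
  set AB : ℝ := (a : ℝ) * (b : ℝ) with hAB
  have hABpos : 0 < AB := by rw [hAB]; exact_mod_cast Nat.mul_pos ha hb
  -- every filling `N ≤ 2ab` lies above the supporting line: `ab·e(n) + s (N - n·ab) ≤ E_open(N)`
  have key : ∀ N ∈ range (2 * (a * b) + 1),
      AB * e + s * ((N : ℝ) - n * AB) ≤ groundEnergy (hubbardOpenBoxTT' a b t t' U) N := by
    intro N hN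
    rcases (Nat.lt_succ_iff.1 (mem_range.1 hN)).lt_or_eq with hlt | rfl
    · -- a proper sector: the open-box consumer and the supporting line at `x = N/(ab)`
      have hx : (N : ℝ) / AB ∈ Set.Ico (0 : ℝ) 2 := by
        refine ⟨by positivity, ?_⟩
        rw [div_lt_iff₀ hABpos]
        have : (N : ℝ) < ((2 * (a * b) : ℕ) : ℝ) := by exact_mod_cast hlt
        push_cast at this
        rw [hAB]; linarith
      have h1 := hs _ hx
      have h2 := energyDensityTT'_le_openBox t t' hU ha hb hlt
      rw [← hAB, le_div_iff₀ hABpos] at h2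
      have h3 : s * ((N : ℝ) / AB - n) * AB = s * ((N : ℝ) - n * AB) := by
        field_simp
      nlinarith [mul_le_mul_of_nonneg_right h1 hABpos.le]
    · -- the filled band `E_open(2ab) = U·ab`
      have hfull : groundEnergy (hubbardOpenBoxTT' a b t t' U) (2 * (a * b)) = U * AB := by
        rw [hubbardOpenBoxTT', ← card_rectSites a b, groundEnergy_hamiltonian_add_full, card_rectSites,
          hAB]
        push_cast; ring
      rw [hfull]
      push_cast
      nlinarith [mul_le_mul_of_nonneg_right hs2 hABpos.le]
  -- average over the number distribution
  have havg : AB * e + s * (∑ N ∈ range (2 * (a * b) + 1), p N * (N : ℝ) - n * AB) ≤ (c + ε) * AB := by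
    have hsum : ∑ N ∈ range (2 * (a * b) + 1), p N * (AB * e + s * ((N : ℝ) - n * AB)) =
        AB * e * ∑ N ∈ range (2 * (a * b) + 1), p N +
          s * (∑ N ∈ range (2 * (a * b) + 1), p N * (N : ℝ) -
            n * AB * ∑ N ∈ range (2 * (a * b) + 1), p N) := by
      rw [Finset.mul_sum, Finset.mul_sum, mul_sub, Finset.mul_sum, Finset.mul_sum, ← Finset.sum_sub_distrib,
        ← Finset.sum_add_distrib]
      exact Finset.sum_congr rfl fun N _ => by ring
    have hle : ∑ N ∈ range (2 * (a * b) + 1), p N * (AB * e + s * ((N : ℝ) - n * AB)) ≤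
        ∑ N ∈ range (2 * (a * b) + 1), p N * groundEnergy (hubbardOpenBoxTT' a b t t' U) N :=
      Finset.sum_le_sum fun N hN => mul_le_mul_of_nonneg_left (key N hN) (hp0 N)
    rw [hsum, hp1, mul_one, mul_one] at hle
    exact hle.trans hpE
  -- the affine term is at least `-|s| ε ab`
  have haff : -(|s| * (ε * AB)) ≤ s * (∑ N ∈ range (2 * (a * b) + 1), p N * (N : ℝ) - n * AB) := by
    have h1 := neg_abs_le (s * (∑ N ∈ range (2 * (a * b) + 1), p N * (N : ℝ) - n * AB))
    rw [abs_mul] at h1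
    rw [hAB] at hpN ⊢
    nlinarith [mul_le_mul_of_nonneg_left hpN (abs_nonneg s), abs_nonneg s]
  -- conclude: `e ≤ c + (1 + |s|) ε < c + ε'`
  have hfin : AB * e ≤ AB * (c + (1 + |s|) * ε) := by nlinarith
  have := le_of_mul_le_mul_left hfin hABpos
  linarith

end ThermodynamicLimit

end Literature.MathematicalPhysics.QuantumLattice

end
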